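import Summits.PneNP.PneNP.Theorems.ChebyshevTracialDesignShellOperatorForm
import Literature.Combinatorics.Optimization.ShellLawRelabeling
import HarnessLib

/-!
# Cell pnp-psdrank, route `ChebyshevTracialDesign`: SWAP SYMMETRY of `H`-symmetric design values — a vertex permutation commuting with the
# matching and preserving the block leaves every design value `Σ_U W(U,M)·ψ(|U∩H|)·F(U)` invariant; same-type edges of `M` can be swapped —
# brick 145a (crux `TracialDecayExp20`, stmt-PneNP-19878)

Brick 145a (prover g29; MEMO-32 §3). For a perfect matching `M` (partner map `π`) and a block `H`, call a permutation `g` of the vertices ADMISSIBLE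
if `g ∘ π = π ∘ g` and `g(H) = H`. Then `U ↦ g(U)` permutes every shell `Shell_c(M)` (`|g(U)| = |U|`, the half edges are transported:
`ShellLawRelabeling.half_map_eq` at `f = g`) and preserves `|U ∩ H|`, so:
* §1 `map_mem_shell_iff`, `sum_shell_map_eq`, **`designValue_map_eq`** — `Σ_U W(U,M)·G(g U) = Σ_U W(U,M)·G(U)` for every `G`, and
  **`pairKernel_perm_eq`** — the pair kernel `A_M(p,q) = Σ_U W(U,M)·ψ(|U∩H|)·x_px_{πp}x_qx_{πq}` satisfies `A_M(gp, gq) = A_M(p,q)`; `type_perm_eq`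
  (the edge type `[p∈H] + [πp∈H]` is `g`-invariant);
* §2 **`exists_admissible_swap`** — for two vertices `a, b` in different edges of `M` with `(a ∈ H ↔ b ∈ H)` and `(πa ∈ H ↔ πb ∈ H)` the product of
  transpositions `(a b)(πa πb)` is admissible, maps `a ↦ b`, and fixes every vertex outside `{a, b, πa, πb}`.
These are the two «single-swap facts» consumed by the type-averaging reduction (brick 145b) in the all-directions form of (CG_1′) for
`H`-symmetric masks (brick 145d). WHAT THIS FILE DOES NOT DO: anything quantitative; anything on `TracialDecayExp20` itself, psd rank of P_PM(K_n),
or P vs NP. [cite: Rothvoss2017, §2 (PDF pp. 5–6)] [cite: GodsilMeagher2015, §15.2]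
Stature: support/instrument (kernel lane, no defs, axioms standard). Supports stmt-PneNP-19878.
-/

set_option linter.dupNamespace false -- `Summit.PneNP.PneNP.…`: summit = sub-problem (D-0017)

noncomputable section

namespace Summit.PneNP.PneNP.Theorems.ChebyshevTracialDesignSwapSymmetry

open Finset Literature.Barriers.PneNP Literature.Combinatorics.Optimization
open Literature.Combinatorics.Optimization.ShellStep
open Summit.PneNP.PneNP.Theorems.ChebyshevTracialDesignShellOperatorForm (designValue_eq_shellAvg)

variable {n : ℕ}

/-! ### §1 Admissible permutations leave shells and design values invariant -/

/-- An admissible permutation maps shells to shells: `g(U) ∈ Shell_c ↔ U ∈ Shell_c`. [cite: Rothvoss2017, §2 (PDF p. 6)] -/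
theorem map_mem_shell_iff {π : Fin n → Fin n} (g : Equiv.Perm (Fin n)) (hgπ : ∀ i, g (π i) = π (g i)) (t c : ℕ)
    (U : Finset (Fin n)) : U.map g.toEmbedding ∈ shell π t c ↔ U ∈ shell π t c := by
  rw [mem_shell, mem_shell, card_map, half_map_eq (π' := π) (f := g.toEmbedding) (fun i => hgπ i), card_map]

/-- Shell sums are invariant under an admissible permutation. [cite: Rothvoss2017, §2 (PDF p. 6)] -/
theorem sum_shell_map_eq {π : Fin n → Fin n} (g : Equiv.Perm (Fin n)) (hgπ : ∀ i, g (π i) = π (g i)) (t c : ℕ)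
    (F : Finset (Fin n) → ℝ) : ∑ U ∈ shell π t c, F (U.map g.toEmbedding) = ∑ U ∈ shell π t c, F U := by
  refine sum_nbij' (fun U => U.map g.toEmbedding) (fun U => U.map g.symm.toEmbedding) ?_ ?_ ?_ ?_ ?_
  · intro U hU; exact (map_mem_shell_iff g hgπ t c U).2 hU
  · intro U hU
    have hg' : ∀ i, g.symm (π i) = π (g.symm i) := fun i => by
      apply g.injective; rw [Equiv.apply_symm_apply, hgπ, Equiv.apply_symm_apply]
    exact (map_mem_shell_iff g.symm hg' t c U).2 hU
  · intro U _; rw [map_map]; convert map_refl (s := U) using 2; ext x; simp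
  · intro U _; rw [map_map]; convert map_refl (s := U) using 2; ext x; simp
  · intro U _; rfl

/-- An `H`-preserving permutation preserves block counts: `|g(U) ∩ H| = |U ∩ H|`. [cite: Rothvoss2017, §2 (PDF p. 6)] -/
theorem card_map_inter_eq' {H : Finset (Fin n)} (g : Equiv.Perm (Fin n)) (hgH : ∀ i, g i ∈ H ↔ i ∈ H) (U : Finset (Fin n)) :
    (U.map g.toEmbedding ∩ H).card = (U ∩ H).card :=
  card_map_inter_eq (f := g.toEmbedding) (H' := H) (fun i => (hgH i).symm) U

/-- **Design values are invariant under admissible permutations**: `Σ_U W(U,M)·G(g U) = Σ_U W(U,M)·G(U)` for every test function `G` of the cut,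
when `g` commutes with the partner map of `M` (`t` odd). [cite: Rothvoss2017, §2 (PDF p. 6)] -/
theorem designValue_map_eq {t : ℕ} (ht : Odd t) (C : Finset ℕ) (w : ℕ → ℝ) (M : PMatch n) (g : Equiv.Perm (Fin n))
    (hgπ : ∀ i, g (M.2.partner i) = M.2.partner (g i)) (G : Finset (Fin n) → ℝ) :
    ∑ U : OddSet n, levelWeight n t C w U M * G (U.1.map g.toEmbedding) = ∑ U : OddSet n, levelWeight n t C w U M * G U.1 := by
  rw [designValue_eq_shellAvg t ht C w M (fun U => G (U.map g.toEmbedding)), designValue_eq_shellAvg t ht C w M G]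
  congr 1
  refine sum_congr rfl fun c _ => ?_
  rw [sum_shell_map_eq g hgπ t c G]

/-- Membership of a vertex in the image cut: `g p ∈ g(U) ↔ p ∈ U`. [folklore] -/
theorem mem_map_perm_iff (g : Equiv.Perm (Fin n)) (U : Finset (Fin n)) (p : Fin n) : g p ∈ U.map g.toEmbedding ↔ p ∈ U := by
  rw [mem_map_equiv, Equiv.symm_apply_apply]

/-- **The pair kernel is invariant**: for admissible `g`, `A_M(gp, gq) = A_M(p, q)` where
`A_M(p,q) = Σ_U W(U,M)·ψ(|U∩H|)·x_px_{πp}x_qx_{πq}`. [cite: Rothvoss2017, §2 (PDF pp. 5–6)] -/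
theorem pairKernel_perm_eq {t : ℕ} (ht : Odd t) (C : Finset ℕ) (w : ℕ → ℝ) (M : PMatch n) (H : Finset (Fin n)) (ψ : ℤ → ℝ)
    (g : Equiv.Perm (Fin n)) (hgπ : ∀ i, g (M.2.partner i) = M.2.partner (g i)) (hgH : ∀ i, g i ∈ H ↔ i ∈ H) (p q : Fin n) :
    ∑ U : OddSet n, levelWeight n t C w U M * (ψ ((U.1 ∩ H).card : ℤ) *
        (((if g p ∈ U.1 then (1 : ℝ) else 0) * (if M.2.partner (g p) ∈ U.1 then (1 : ℝ) else 0)) *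
          ((if g q ∈ U.1 then (1 : ℝ) else 0) * (if M.2.partner (g q) ∈ U.1 then (1 : ℝ) else 0)))) =
      ∑ U : OddSet n, levelWeight n t C w U M * (ψ ((U.1 ∩ H).card : ℤ) *
        (((if p ∈ U.1 then (1 : ℝ) else 0) * (if M.2.partner p ∈ U.1 then (1 : ℝ) else 0)) *
          ((if q ∈ U.1 then (1 : ℝ) else 0) * (if M.2.partner q ∈ U.1 then (1 : ℝ) else 0)))) := by
  rw [← designValue_map_eq ht C w M g hgπ (fun U => ψ ((U ∩ H).card : ℤ) *
    (((if g p ∈ U then (1 : ℝ) else 0) * (if M.2.partner (g p) ∈ U then (1 : ℝ) else 0)) *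
      ((if g q ∈ U then (1 : ℝ) else 0) * (if M.2.partner (g q) ∈ U then (1 : ℝ) else 0))))]
  refine Fintype.sum_congr _ _ fun U => ?_
  simp only [card_map_inter_eq' g hgH, ← hgπ, mem_map_perm_iff]

/-- The edge type `[p ∈ H] + [πp ∈ H]` is invariant under admissible permutations. [cite: Rothvoss2017, §2 (PDF p. 5)] -/
theorem type_perm_eq (M : PMatch n) (H : Finset (Fin n)) (g : Equiv.Perm (Fin n))
    (hgπ : ∀ i, g (M.2.partner i) = M.2.partner (g i)) (hgH : ∀ i, g i ∈ H ↔ i ∈ H) (p : Fin n) :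
    (if g p ∈ H then 1 else 0) + (if M.2.partner (g p) ∈ H then 1 else 0) =
      ((if p ∈ H then 1 else 0) + (if M.2.partner p ∈ H then 1 else 0) : ℕ) := by
  rw [← hgπ]
  simp only [hgH]

/-! ### §2 Swapping two same-type edges -/

/-- **The swap of two same-type edges is admissible.** For vertices `a, b` in different edges of `M` (`b ∉ {a, πa}`) with `a ∈ H ↔ b ∈ H` and
`πa ∈ H ↔ πb ∈ H`, the permutation `(a b)(πa πb)` commutes with `π`, preserves `H`, maps `a ↦ b`, and fixes every vertex outside
`{a, b, πa, πb}`. [cite: Rothvoss2017, §2 (PDF p. 5)] -/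
theorem exists_admissible_swap (M : PMatch n) (H : Finset (Fin n)) {a b : Fin n} (hba : b ≠ a) (hbπa : b ≠ M.2.partner a)
    (haH : a ∈ H ↔ b ∈ H) (hπH : M.2.partner a ∈ H ↔ M.2.partner b ∈ H) :
    ∃ g : Equiv.Perm (Fin n), (∀ i, g (M.2.partner i) = M.2.partner (g i)) ∧ (∀ i, g i ∈ H ↔ i ∈ H) ∧ g a = b ∧
      ∀ x, x ≠ a → x ≠ b → x ≠ M.2.partner a → x ≠ M.2.partner b → g x = x := by
  have hπ : ∀ v, M.2.partner (M.2.partner v) = v := partner_partner M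
  have hπ' : ∀ v, M.2.partner v ≠ v := partner_ne M
  -- the four vertices `a, b, πa, πb` are pairwise distinct
  have d1 : M.2.partner a ≠ a := hπ' a
  have d2 : M.2.partner b ≠ b := hπ' b
  have d5 : M.2.partner b ≠ a := fun h => hbπa (by rw [← h, hπ])
  have d6 : M.2.partner b ≠ M.2.partner a := fun h => hba (by rw [← hπ b, h, hπ])
  refine ⟨Equiv.swap a b * Equiv.swap (M.2.partner a) (M.2.partner b), ?_⟩
  -- the values of `g`
  have ga : (Equiv.swap a b * Equiv.swap (M.2.partner a) (M.2.partner b)) a = b := by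
    rw [Equiv.Perm.mul_apply, Equiv.swap_apply_of_ne_of_ne d1.symm d5.symm, Equiv.swap_apply_left]
  have gb : (Equiv.swap a b * Equiv.swap (M.2.partner a) (M.2.partner b)) b = a := by
    rw [Equiv.Perm.mul_apply, Equiv.swap_apply_of_ne_of_ne hbπa d2.symm, Equiv.swap_apply_right]
  have gπa : (Equiv.swap a b * Equiv.swap (M.2.partner a) (M.2.partner b)) (M.2.partner a) = M.2.partner b := by
    rw [Equiv.Perm.mul_apply, Equiv.swap_apply_left, Equiv.swap_apply_of_ne_of_ne d5 d2]
  have gπb : (Equiv.swap a b * Equiv.swap (M.2.partner a) (M.2.partner b)) (M.2.partner b) = M.2.partner a := by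
    rw [Equiv.Perm.mul_apply, Equiv.swap_apply_right, Equiv.swap_apply_of_ne_of_ne d1 hbπa.symm]
  have gx : ∀ x, x ≠ a → x ≠ b → x ≠ M.2.partner a → x ≠ M.2.partner b →
      (Equiv.swap a b * Equiv.swap (M.2.partner a) (M.2.partner b)) x = x := by
    intro x h1 h2 h3 h4
    rw [Equiv.Perm.mul_apply, Equiv.swap_apply_of_ne_of_ne h3 h4, Equiv.swap_apply_of_ne_of_ne h1 h2]
  refine ⟨?_, ?_, ga, gx⟩
  · -- commutes with `π`
    intro i
    by_cases h1 : i = a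
    · rw [h1, ga, gπa]
    by_cases h2 : i = b
    · rw [h2, gb, gπb]
    by_cases h3 : i = M.2.partner a
    · rw [h3, hπ, gπa, ga, hπ]
    by_cases h4 : i = M.2.partner b
    · rw [h4, hπ, gπb, gb, hπ]
    have k1 : M.2.partner i ≠ a := fun h => h3 (by rw [← h, hπ])
    have k2 : M.2.partner i ≠ b := fun h => h4 (by rw [← h, hπ])
    have k3 : M.2.partner i ≠ M.2.partner a := fun h => h1 (by rw [← hπ i, h, hπ])
    have k4 : M.2.partner i ≠ M.2.partner b := fun h => h2 (by rw [← hπ i, h, hπ])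
    rw [gx i h1 h2 h3 h4, gx _ k1 k2 k3 k4]
  · -- preserves `H`
    intro i
    by_cases h1 : i = a
    · rw [h1, ga]; exact haH.symm
    by_cases h2 : i = b
    · rw [h2, gb]; exact haH
    by_cases h3 : i = M.2.partner a
    · rw [h3, gπa]; exact hπH.symm
    by_cases h4 : i = M.2.partner b
    · rw [h4, gπb]; exact hπH
    rw [gx i h1 h2 h3 h4]

end Summit.PneNP.PneNP.Theorems.ChebyshevTracialDesignSwapSymmetry

end
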